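import Mathlib.MeasureTheory.Function.LpSeminorm.Basic
import Literature.Analysis.FluidPDE.SelfSimilar
import HarnessLib

/-!
# Tsai's growth lemmas for Leray profiles in `L^q` (Tsai 1998, §2–§3): named facts

Analysis/FluidPDE fact file for the decomposition of the named fact
`Literature.Analysis.FluidPDE.tsai_selfsimilar` (`FluidPDE/SelfSimilarLiouville`; T.-P. Tsai,
*On Leray's self-similar solutions of the Navier–Stokes equations satisfying local energy
estimates*, Arch. Rational Mech. Anal. 143 (1998) 29–51, **Theorem 1**: a weak solution `U` of
Leray's profile system (1.3) with `U ∈ L^q(ℝ³)`, `3 < q < ∞`, vanishes).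

Tsai's proof of Theorem 1 (p. 32: "the reader may just assume (1.10) and go directly to
Section 5"; p. 48, "Proofs of Theorems 1 and 2") has two halves:

* **the growth estimates (1.10)** `U(y) = o(|y|)`, `P(y) = O(|y|^N)` as `|y| → ∞` — §2–§3:
  regularity of weak solutions (p. 33), the pressure `P̃ = RᵢRⱼ(UᵢUⱼ)` and `P − P̃ = const`
  (Lemma 2.1), the local gradient estimate (Lemma 3.1), a bootstrap through the interior `L^p`
  estimates for the Stokes system and Sobolev imbedding (Lemma 3.2: `P = O(|y|^N)`), and Green's
  representation formula for the Stokes system on balls with the Leray–Hardy inequality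
  (Lemma 3.3: `U = o(|y|)`);
* **the Liouville-type Lemma 5.1** for the head pressure `Π = ½|U|² + P + a y·U`, which by (1.7)
  satisfies `−νΔΠ + (U + ay)·∇Π ≤ 0`, followed by `ΔU = 0` and the Liouville theorem in `L^q`.

The second half is **proved** in the tree (`TsaiMaximumPrinciple`: Lemma 5.1;
`TsaiHeadPressure`/`TsaiHeadPressureIdentity`: (1.7) and `ΔU = 0`; `HarmonicLiouvilleLp`), and
`SelfSimilarLiouvilleProofs` assembles Theorem 1 from it and from the three inputs of the first
half, which are vendored here as named facts (their printed proofs rest on elliptic regularity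
for the stationary Navier–Stokes system, Calderón–Zygmund / Riesz-transform bounds, interior
`L^p` estimates and Green's tensor for the Stokes system on balls — Galdi's treatise —, none of
which Mathlib or `Literature` has at present):

* `tsai1998_profile_smooth` — p. 33: "By standard regularity theory of stationary Navier–Stokes
  equations, every weak solution `U` of (1.3) is actually smooth (see, for example, [Ga II, GiM,
  La, Te])";
* `tsai1998_lemma32` — **Lemma 3.2** (p. 39): `U ∈ L^q`, `3 ≤ q ≤ ∞` ⟹ `|P(y₀)| = O(|y₀|^N)`;
* `tsai1998_lemma33` — **Lemma 3.3** (p. 40): `U ∈ L^q`, `3 < q < ∞` ⟹ `U(y) = o(|y|)`.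

## The profile class

In print a *weak solution of (1.3)* is `U ∈ W^{1,2}_loc(ℝ³)` with `div U = 0` and
`∫ (ν∇U·∇φ + [aU + a(y·∇)U + (U·∇)U]·φ) = 0` for all divergence-free `φ ∈ C_c^∞` (p. 33), the
pressure being any `P` such that `(U, P)` satisfies (1.3) in bounded regions ("In any given
connected region, `P` is unique up to a constant … In this way we can define `P` globally",
p. 34; this is the `P` of Lemma 3.2, and Lemma 2.1 identifies it with `P̃ = RᵢRⱼ(UᵢUⱼ)` up to an
additive constant for `q < ∞`, up to an affine function for `q = ∞`). The facts below are stated,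
like the target `tsai_selfsimilar`, for the tree's pointwise class `IsLerayProfile ν a U P`
(`U ∈ C²`, `P ∈ C¹`, `−νΔU + aU + a(y·∇)U + (U·∇)U + ∇P = 0` and `div U = 0` pointwise on `ℝ³`),
which is contained in the printed one: such a `U` is in `W^{1,2}_loc`, the weak identity follows
by multiplying the pointwise equation by `φ` and integrating by parts (`∫ ∇P·φ = −∫ P div φ = 0`),
and `P` is a pressure "defined as in Section 2" (with the fixed constant `∫_{B₁} P`). The
standing hypotheses `ν > 0` ((1.1)) and `a > 0` ((1.2)) of the paper are kept. Physical space is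
`ℝ³ = EuclideanSpace ℝ (Fin 3)` with Lebesgue measure; `U ∈ L^q` is Mathlib's `MemLp U q`.

Deliberately **not** vendored: Lemma 2.1 and Lemma 3.1 themselves (only used inside the proofs of
Lemmas 3.2–3.3), the alternative route of §3.4 for `3 ≤ q < 9`, and the case `q = ∞` of Theorem 1
(`U` constant), which the target `tsai_selfsimilar` excludes.

## References

* T.-P. Tsai, *On Leray's self-similar solutions of the Navier–Stokes equations satisfying local
  energy estimates*, Arch. Rational Mech. Anal. 143 (1998) 29–51: p. 33 (weak solutions,
  regularity), Lemma 2.1 (p. 34), Lemma 3.1 (p. 36), Lemma 3.2 (p. 39), Lemma 3.3 (p. 40),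
  §5 (p. 48) [Tsai1998].
* G. P. Galdi, *An introduction to the mathematical theory of the Navier–Stokes equations*, I–II,
  Springer (1994) — Tsai's [Ga]: Stokes estimates (I, pp. 180, 208, 226–234) and regularity of
  the stationary system (II).
-/

noncomputable section

open MeasureTheory
open scoped ContDiff ENNReal

namespace Literature.Analysis.FluidPDE

/-- Local notation for physical space `ℝ³ = EuclideanSpace ℝ (Fin 3)`. -/
local notation "ℝ³" => EuclideanSpace ℝ (Fin 3)

/-- **Tsai 1998, p. 33 (regularity of weak solutions of Leray's system)**: "By standard
regularity theory of stationary Navier–Stokes equations, every weak solution `U` of (1.3) is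
actually smooth (see, for example, [Ga II, GiM, La, Te])." Rendered for the tree's pointwise
profile class (module docstring): for `ν > 0`, `a > 0`, if `(U, P)` is a Leray profile on `ℝ³`
(`IsLerayProfile ν a U P`: `U ∈ C²`, `P ∈ C¹` solving (1.3) pointwise), then `U ∈ C^∞(ℝ³)`.
(Then `P` is smooth too — p. 34, "Since `U` is smooth, `P` is also smooth" —, which is *proved*
from this fact in `TsaiHeadPressure`, `IsLerayProfile.contDiff_pressure_of_smooth`.) Interior
elliptic regularity for the stationary Navier–Stokes / Stokes system is not in Mathlib; named
fact. [cite: Tsai1998, p. 33] -/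
def tsai1998_profile_smooth : Prop :=
  ∀ {ν a : ℝ} (hν : 0 < ν) (ha : 0 < a) {U : ℝ³ → ℝ³} {P : ℝ³ → ℝ}
    (hprof : FluidPDE.IsLerayProfile ν a U P), ContDiff ℝ ∞ U

/-- **Tsai 1998, Lemma 3.2** (p. 39): "Let `U` be a weak solution of (1.3) and let `P` be
defined as in Section 2. If `U ∈ L^q(ℝ³)`, `3 ≤ q ≤ ∞`, then `|P(y₀)| = O(|y₀|^N)` as `y₀ → ∞`
for some `N < ∞`." Rendered for the tree's pointwise profile class (module docstring; the `P` of
an `IsLerayProfile` pair is a pressure "defined as in Section 2"): for `ν > 0`, `a > 0`, a Leray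
profile `(U, P)` on `ℝ³` with `U ∈ L^q`, `3 ≤ q ≤ ∞`, admits `N ∈ ℕ` and `C, R` with
`|P(y)| ≤ C |y|^N` whenever `|y| ≥ R`. (Proof in print: Lemma 2.1, the gradient estimate (3.1),
and a bootstrap through the interior `L^p` estimates (3.2) for the Stokes system and Sobolev
imbedding; for `q = ∞` also the BMO bound (2.4) on `P̃`.) [cite: Tsai1998, Lemma 3.2 (p. 39)] -/
def tsai1998_lemma32 : Prop :=
  ∀ {ν a : ℝ} (hν : 0 < ν) (ha : 0 < a) {U : ℝ³ → ℝ³} {P : ℝ³ → ℝ}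
    (hprof : FluidPDE.IsLerayProfile ν a U P) {q : ℝ≥0∞} (hq : 3 ≤ q) (hU : MemLp U q),
    ∃ (N : ℕ) (C R : ℝ), ∀ y : ℝ³, R ≤ ‖y‖ → |P y| ≤ C * ‖y‖ ^ N

/-- **Tsai 1998, Lemma 3.3** (p. 40): "Let `U` be a weak solution of (1.3). If `U ∈ L^q(ℝ³)`,
`3 < q < ∞`, then `U(y) = o(|y|)` as `y → ∞`." Rendered for the tree's pointwise profile class
(module docstring): for `ν > 0`, `a > 0`, a Leray profile `(U, P)` on `ℝ³` with `U ∈ L^q`,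
`3 < q < ∞`, satisfies: for every `ε > 0` there is `R` with `|U(y)| ≤ ε|y|` whenever `|y| ≥ R`.
(Proof in print: Green's representation formula for the Stokes system on balls `B_ρ(y₀)`,
the estimates (3.6)–(3.9) of the Green tensor, Lemma 3.1 and the Leray–Hardy inequality (3.10);
§3.3 normalises `ν = 1`, which is restored by the scaling `U(y) = √ν V(y/√ν)`,
`P(y) = ν Q(y/√ν)` of (1.3).) [cite: Tsai1998, Lemma 3.3 (p. 40)] -/
def tsai1998_lemma33 : Prop :=
  ∀ {ν a : ℝ} (hν : 0 < ν) (ha : 0 < a) {U : ℝ³ → ℝ³} {P : ℝ³ → ℝ}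
    (hprof : FluidPDE.IsLerayProfile ν a U P) {q : ℝ≥0∞} (hq : 3 < q) (hq' : q < (⊤ : ℝ≥0∞))
    (hU : MemLp U q),
    ∀ ε : ℝ, 0 < ε → ∃ R : ℝ, ∀ y : ℝ³, R ≤ ‖y‖ → ‖U y‖ ≤ ε * ‖y‖

end Literature.Analysis.FluidPDE

end
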